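import Summits.CriticalPhenomena.PercolationContinuityZ3.Theorems.PercNearOneGluingNoHeavyLowerTailHubPairTermRel
import Summits.CriticalPhenomena.PercolationContinuityZ3.Theorems.PercNearOneGluingNoHeavyLowerTailApexTwoSumTools
import HarnessLib

/-!
# `NoHeavyLowerTail` (stmt-CriticalPhenomena-4575) — HUB PAIRS WITH A TERMINAL ALONE ON ITS SIDE, part 4:
# R1 across a terminal-isolating hub pair from three R1 instances and four HUB-CROSS rows of the near side (every `q > 0`)

Support file (prover prim-gen-kcluster gen 72; `--supports stmt-CriticalPhenomena-4575`).  No definitions, no named facts, no sorries.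
This is KCLUSTER-gen65 §11 (`Split21.split21_identity`, p-landed as `…Split21Blocks`) at the MEASURE LEVEL and with the near side ARBITRARY: the
k-state dictionary of gen 65 is replaced by the eight-state dictionary of parts 2–3, whose near-side functionals are intrinsic events, and the 2|1
identity is re-proved in these variables (`split21_pos`: it holds given seven linear relations between the event masses, all pointwise).

SETTING.  `V` finite; apex `a`, terminals `b, c`, hubs `h₀ ≠ h₁`; supports `DX` (the arm of `c`: `c ∈ V(DX)`, `c` reaches both hubs inside `DX`;
`a, b ∉ V(DX)`) and `DK` (the near side, `c ∉ V(DK)`), meeting only in `{h₀, h₁}`; `D = DX ∪ DK`; weights `w` on `DX ∪ DK`, `wX = w·1_{DX}`,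
`wK = w·1_{DXᶜ}`; `φ = rcMeasureW w q ∅`, `φ_X`, `φ_K = rcMeasureW wK q ∅` and the hub-wired `φ_K^w = rcMeasureW wK q {h₀,h₁}` (its events are read
after inserting the pair `h₀h₁`).  Near-side atoms: `B = [b ∈ C(a)]`, `H_i = [h_i ∈ C(a)]`, `S_i = Sep DK C(a) b h_i`.
HYPOTHESES.  Arm: R1 for `(h₀; c, h₁)` and `(h₁; c, h₀)`, FKG slack for `(h₀; c, h₁)` (automatic for `q ≥ 1`), `φ_X(c, h₁ ∈ C(h₀)) ≠ 0`.
Near side (gen 65 §11, Corollary C): R1 for `(a; b, h₀)`, `(a; b, h₁)` on `φ_K`, R1 for `(a; b, h)` on `φ_K^w`; the HUB-CROSS rows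
`HC1_h : Sb_h·T^w + S^w·T_h ≤ Uc'_h·Ub'^w + Uc'^w·Ub'_h` (`h = h₀, h₁`), `HC2 : Sm·T^w ≤ Uc'^w·Um`, `HC3 : Sb₀T₁ + Sb₁T₀ ≤ Uc'₀Ub'₁ + Uc'₁Ub'₀`, where
`T_h = {B∧H_h}`, `Ub'_h = {B∧¬H_h}`, `Uc'_h = {¬B∧H_h}`, `Sb₀ = {¬B∧¬H₀∧S₀∧(H₁∨S₁)}`, `Um = {B}`, `Sm = {¬B∧(H₀∨S₀)∧(H₁∨S₁)}`, and `T^w, Ub'^w, Uc'^w,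
S^w = {¬B∧¬H₀∧S₀∧S₁}` read on `φ_K^w`.
**THEOREM** (`HubPairTerm.r1_of_near_side`): then R1 holds for `(a; b, c)` on `φ` with support `D`.  Hence (gen 65 Corollary C, now kernel modulo
landing): a minimal counterexample to R1-RC(q ≥ 1) has no terminal-isolating hub pair UNLESS one of the hub-cross rows HC1–HC3 fails on the near side.
-/

noncomputable section

namespace Summit.CriticalPhenomena.PercolationContinuityZ3.Theorems

namespace HubPairTerm

open Finset SimpleGraph Literature.Probability.Percolation Literature.Probability.Percolation.Gladkov
open Literature.Probability.Percolation.BHK2006 (weight)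
open Literature.Probability.Percolation.DecisionTree (ind ind_of_mem ind_of_not_mem ind_nonneg)
open Literature.Probability.LatticeModels RefinedRowR3 ThreePointLB APL MeasureTheory
open scoped Classical

variable {V : Type*} [Fintype V]

section Main

variable {DX DK D : Finset (Sym2 V)} {a b c h₀ h₁ : V} (h01 : h₀ ≠ h₁) (hb0 : b ≠ h₀) (hb1 : b ≠ h₁) (hc0 : c ≠ h₀) (hc1 : c ≠ h₁)
  (hbc : b ≠ c) (hca : c ≠ a)
  (hsepD : ∀ t : V, (∃ e ∈ DX, t ∈ e) → (∃ e ∈ DK, t ∈ e) → (t = h₀ ∨ t = h₁))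
  (haX : ∀ e ∈ DX, a ∉ e) (hbX : ∀ e ∈ DX, b ∉ e) (hcK : ∀ e ∈ DK, c ∉ e)
  (hcX0 : c ∈ cl DX h₀) (hcX1 : c ∈ cl DX h₁) (hD : ∀ e, e ∈ D ↔ e ∈ DX ∨ e ∈ DK)
  (w wX wK : Sym2 V → unitInterval) {q : ℝ} (hq : 0 < q) (hw : ∀ e, e ∉ (↑DX ∪ ↑DK : Set (Sym2 V)) → (w e : ℝ) = 0)
  (hX : ∀ e ∈ (↑DX : Set (Sym2 V)), wX e = w e) (hX' : ∀ e ∉ (↑DX : Set (Sym2 V)), wX e = 0)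
  (hY : ∀ e ∈ (↑DX : Set (Sym2 V)), wK e = 0) (hY' : ∀ e ∉ (↑DX : Set (Sym2 V)), wK e = w e)

/-! ### The theorem -/

include h01 hb0 hb1 hc0 hc1 hbc hca hsepD haX hbX hcK hcX0 hcX1 hD hq hw hX hX' hY hY' in
/-- **R1 across a terminal-isolating hub pair** (KCLUSTER-gen65 §11 / Corollary C at the measure level; see the module docstring). [this work] -/
theorem r1_of_near_side
    (hR1X : (rcMeasureW wX q ∅).real {η : BondConfig V | c ∈ cl η.toFinset h₀ ∧ h₁ ∈ cl η.toFinset h₀} * (rcMeasureW wX q ∅).real {η : BondConfig V | c ∉ cl η.toFinset h₀ ∧ h₁ ∉ cl η.toFinset h₀ ∧ Sep DX (cl η.toFinset h₀) c h₁} ≤ (rcMeasureW wX q ∅).real {η : BondConfig V | c ∈ cl η.toFinset h₀ ∧ h₁ ∉ cl η.toFinset h₀} * (rcMeasureW wX q ∅).real {η : BondConfig V | c ∉ cl η.toFinset h₀ ∧ h₁ ∈ cl η.toFinset h₀}) (hR2X : (rcMeasureW wX q ∅).real {η : BondConfig V | c ∈ cl η.toFinset h₁ ∧ h₀ ∈ cl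 η.toFinset h₁} * (rcMeasureW wX q ∅).real {η : BondConfig V | c ∉ cl η.toFinset h₁ ∧ h₀ ∉ cl η.toFinset h₁ ∧ Sep DX (cl η.toFinset h₁) c h₀} ≤ (rcMeasureW wX q ∅).real {η : BondConfig V | c ∈ cl η.toFinset h₁ ∧ h₀ ∉ cl η.toFinset h₁} * (rcMeasureW wX q ∅).real {η : BondConfig V | c ∉ cl η.toFinset h₁ ∧ h₀ ∈ cl η.toFinset h₁})
    (hFX : (rcMeasureW wX q ∅).real {η : BondConfig V | c ∉ cl η.toFinset h₀ ∧ h₁ ∈ cl η.toFinset h₀} * ((rcMeasureW wX q ∅).real {η : BondConfig V | c ∈ cl η.toFinset h₀ ∧ h₁ ∉ cl η.toFinset h₀} + (rcMeasureW wX q ∅).real {η : BondConfig V | c ∉ cl η.toFinset h₀ ∧ h₁ ∉ cl η.toFinset h₀ ∧ h₁ ∈ cl η.toFinset c}) ≤ (rcMeasureW wX q ∅).real {η : BondConfig V | c ∈ cl η.toFinset h₀ ∧ h₁ ∈ cl η.toFinset h₀} * (rcMeasureW wX q ∅).real {η : BondConfig V | c ∉ cl η.toFinset h₀ ∧ h₁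 ∉ cl η.toFinset h₀ ∧ h₁ ∉ cl η.toFinset c}) (hAX : (rcMeasureW wX q ∅).real {η : BondConfig V | c ∈ cl η.toFinset h₀ ∧ h₁ ∈ cl η.toFinset h₀} ≠ 0)
    (hR10 : (rcMeasureW wK q ∅).real {η : BondConfig V | b ∈ cl η.toFinset a ∧ h₀ ∈ cl η.toFinset a} * (rcMeasureW wK q ∅).real {η : BondConfig V | b ∉ cl η.toFinset a ∧ h₀ ∉ cl η.toFinset a ∧ Sep DK (cl η.toFinset a) b h₀} ≤ (rcMeasureW wK q ∅).real {η : BondConfig V | b ∈ cl η.toFinset a ∧ h₀ ∉ cl η.toFinset a} * (rcMeasureW wK q ∅).real {η : BondConfig V | b ∉ cl η.toFinset a ∧ h₀ ∈ cl η.toFinset a}) (hR11 : (rcMeasureW wK q ∅).real {η : BondConfig V | b ∈ cl η.toFinset a ∧ h₁ ∈ cl η.toFinset a} * (rcMeasureW wK q ∅).real {η : BondConfig V | b ∉ cl η.toFinset a ∧ h₁ ∉ cl η.toFinset a ∧ Sep DK (cl η.toFinset a) b h₁} ≤ (rcMeasureW wK q ∅).real {η : BondConfig V | b ∈ cl η.toFinset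 a ∧ h₁ ∉ cl η.toFinset a} * (rcMeasureW wK q ∅).real {η : BondConfig V | b ∉ cl η.toFinset a ∧ h₁ ∈ cl η.toFinset a})
    (hR1w : (rcMeasureW wK q ({h₀, h₁} : Set V)).real {η : BondConfig V | insert s(h₀, h₁) η ∈ {η : BondConfig V | b ∈ cl η.toFinset a ∧ h₀ ∈ cl η.toFinset a}} * (rcMeasureW wK q ({h₀, h₁} : Set V)).real {η : BondConfig V | insert s(h₀, h₁) η ∈ {η : BondConfig V | b ∉ cl η.toFinset a ∧ h₀ ∉ cl η.toFinset a ∧ Sep DK (cl η.toFinset a) b h₀ ∧ Sep DK (cl η.toFinset a) b h₁}} ≤ (rcMeasureW wK q ({h₀, h₁} : Set V)).real {η : BondConfig V | insert s(h₀, h₁) η ∈ {η : BondConfig V | b ∈ cl η.toFinset a ∧ h₀ ∉ cl η.toFinset a}} * (rcMeasureW wK q ({h₀, h₁} : Set V)).real {η : BondConfig V | insert s(h₀, h₁) η ∈ {η : BondConfig V | b ∉ cl η.toFinset a ∧ h₀ ∈ cl η.toFinset a}})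
    (hHC10 : (rcMeasureW wK q ∅).real {η : BondConfig V | b ∉ cl η.toFinset a ∧ h₀ ∉ cl η.toFinset a ∧ Sep DK (cl η.toFinset a) b h₀ ∧ (h₁ ∈ cl η.toFinset a ∨ Sep DK (cl η.toFinset a) b h₁)} * (rcMeasureW wK q ({h₀, h₁} : Set V)).real {η : BondConfig V | insert s(h₀, h₁) η ∈ {η : BondConfig V | b ∈ cl η.toFinset a ∧ h₀ ∈ cl η.toFinset a}} + (rcMeasureW wK q ({h₀, h₁} : Set V)).real {η : BondConfig V | insert s(h₀, h₁) η ∈ {η : BondConfig V | b ∉ cl η.toFinset a ∧ h₀ ∉ cl η.toFinset a ∧ Sep DK (cl η.toFinset a) b h₀ ∧ Sep DK (cl η.toFinset a) b h₁}} * (rcMeasureW wK q ∅).real {η : BondConfig V | b ∈ cl η.toFinset a ∧ h₀ ∈ cl η.toFinset a} ≤ (rcMeasureW wK q ∅).real {η : BondConfig V | b ∉ cl η.toFinset a ∧ h₀ ∈ cl η.toFinset a} * (rcMeasureW wK q ({h₀, h₁} : Set V)).real {η : BondConfig V | insert s(h₀, h₁) η ∈ {η : BondConfig V | b ∈ cl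 η.toFinset a ∧ h₀ ∉ cl η.toFinset a}} + (rcMeasureW wK q ({h₀, h₁} : Set V)).real {η : BondConfig V | insert s(h₀, h₁) η ∈ {η : BondConfig V | b ∉ cl η.toFinset a ∧ h₀ ∈ cl η.toFinset a}} * (rcMeasureW wK q ∅).real {η : BondConfig V | b ∈ cl η.toFinset a ∧ h₀ ∉ cl η.toFinset a})
    (hHC11 : (rcMeasureW wK q ∅).real {η : BondConfig V | b ∉ cl η.toFinset a ∧ h₁ ∉ cl η.toFinset a ∧ Sep DK (cl η.toFinset a) b h₁ ∧ (h₀ ∈ cl η.toFinset a ∨ Sep DK (cl η.toFinset a) b h₀)} * (rcMeasureW wK q ({h₀, h₁} : Set V)).real {η : BondConfig V | insert s(h₀, h₁) η ∈ {η : BondConfig V | b ∈ cl η.toFinset a ∧ h₀ ∈ cl η.toFinset a}} + (rcMeasureW wK q ({h₀, h₁} : Set V)).real {η : BondConfig V | insert s(h₀, h₁) η ∈ {η : BondConfig V | b ∉ cl η.toFinset a ∧ h₀ ∉ cl η.toFinset a ∧ Sep DK (cl η.toFinset a) b h₀ ∧ Sep DK (cl η.toFinset a) b h₁}} * (rcMeasureW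 wK q ∅).real {η : BondConfig V | b ∈ cl η.toFinset a ∧ h₁ ∈ cl η.toFinset a} ≤ (rcMeasureW wK q ∅).real {η : BondConfig V | b ∉ cl η.toFinset a ∧ h₁ ∈ cl η.toFinset a} * (rcMeasureW wK q ({h₀, h₁} : Set V)).real {η : BondConfig V | insert s(h₀, h₁) η ∈ {η : BondConfig V | b ∈ cl η.toFinset a ∧ h₀ ∉ cl η.toFinset a}} + (rcMeasureW wK q ({h₀, h₁} : Set V)).real {η : BondConfig V | insert s(h₀, h₁) η ∈ {η : BondConfig V | b ∉ cl η.toFinset a ∧ h₀ ∈ cl η.toFinset a}} * (rcMeasureW wK q ∅).real {η : BondConfig V | b ∈ cl η.toFinset a ∧ h₁ ∉ cl η.toFinset a})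
    (hHC2 : (rcMeasureW wK q ∅).real {η : BondConfig V | b ∉ cl η.toFinset a ∧ (h₀ ∈ cl η.toFinset a ∨ Sep DK (cl η.toFinset a) b h₀) ∧ (h₁ ∈ cl η.toFinset a ∨ Sep DK (cl η.toFinset a) b h₁)} * (rcMeasureW wK q ({h₀, h₁} : Set V)).real {η : BondConfig V | insert s(h₀, h₁) η ∈ {η : BondConfig V | b ∈ cl η.toFinset a ∧ h₀ ∈ cl η.toFinset a}} ≤ (rcMeasureW wK q ({h₀, h₁} : Set V)).real {η : BondConfig V | insert s(h₀, h₁) η ∈ {η : BondConfig V | b ∉ cl η.toFinset a ∧ h₀ ∈ cl η.toFinset a}} * (rcMeasureW wK q ∅).real {η : BondConfig V | b ∈ cl η.toFinset a})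
    (hHC3 : (rcMeasureW wK q ∅).real {η : BondConfig V | b ∉ cl η.toFinset a ∧ h₀ ∉ cl η.toFinset a ∧ Sep DK (cl η.toFinset a) b h₀ ∧ (h₁ ∈ cl η.toFinset a ∨ Sep DK (cl η.toFinset a) b h₁)} * (rcMeasureW wK q ∅).real {η : BondConfig V | b ∈ cl η.toFinset a ∧ h₁ ∈ cl η.toFinset a} + (rcMeasureW wK q ∅).real {η : BondConfig V | b ∉ cl η.toFinset a ∧ h₁ ∉ cl η.toFinset a ∧ Sep DK (cl η.toFinset a) b h₁ ∧ (h₀ ∈ cl η.toFinset a ∨ Sep DK (cl η.toFinset a) b h₀)} * (rcMeasureW wK q ∅).real {η : BondConfig V | b ∈ cl η.toFinset a ∧ h₀ ∈ cl η.toFinset a} ≤ (rcMeasureW wK q ∅).real {η : BondConfig V | b ∉ cl η.toFinset a ∧ h₀ ∈ cl η.toFinset a} * (rcMeasureW wK q ∅).real {η : BondConfig V | b ∈ cl η.toFinset a ∧ h₁ ∉ cl η.toFinset a} + (rcMeasureW wK q ∅).real {η : BondConfig V | b ∉ cl η.toFinset a ∧ h₁ ∈ cl η.toFinset a} * (rcMeasureW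 wK q ∅).real {η : BondConfig V | b ∈ cl η.toFinset a ∧ h₀ ∉ cl η.toFinset a}) :
    (rcMeasureW w q ∅).real {η : BondConfig V | b ∈ cl η.toFinset a ∧ c ∈ cl η.toFinset a} * (rcMeasureW w q ∅).real {η : BondConfig V | b ∉ cl η.toFinset a ∧ c ∉ cl η.toFinset a ∧ Sep D (cl η.toFinset a) b c} ≤ (rcMeasureW w q ∅).real {η : BondConfig V | b ∈ cl η.toFinset a ∧ c ∉ cl η.toFinset a} * (rcMeasureW w q ∅).real {η : BondConfig V | b ∉ cl η.toFinset a ∧ c ∈ cl η.toFinset a} := by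
  have hDD : D = DX ∪ DK := by ext e; rw [hD e, Finset.mem_union]
  subst hDD
  obtain ⟨φX, ρX, σX, pXA⟩ := ThetaFar.armB_slacks (DB := DX) (b := c) h01 wX hq hR1X hR2X hFX hAX
  have hZ := rcPartitionFunctionW_pos w hq (∅ : Set V)
  have hZK := rcPartitionFunctionW_pos wK hq (∅ : Set V)
  have hZW := rcPartitionFunctionW_pos wK hq ({h₀, h₁} : Set V)
  have hK : 0 < q ^ clusterCount (∅ : BondConfig V) ({h₀, h₁} : Set V) := pow_pos hq _
  have hnnX : ∀ (E : Set (BondConfig V)), 0 ≤ ∑ η : BondConfig V, rcWeightW wX q ({h₀, h₁} : Set V) η * ind E η := fun E =>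
    Finset.sum_nonneg fun η _ => mul_nonneg (rcWeightW_nonneg wX hq.le _ η) (ind_nonneg E η)
  have hnnW : ∀ (E : Set (BondConfig V)), 0 ≤ ∑ η : BondConfig V, rcWeightW wK q ({h₀, h₁} : Set V) η * ind E η := fun E =>
    Finset.sum_nonneg fun η _ => mul_nonneg (rcWeightW_nonneg wK hq.le _ η) (ind_nonneg E η)
  have hnnR : ∀ (E : Set (BondConfig V)), 0 ≤ ∑ η : BondConfig V, rcWeightW wK q ({h₀, h₁} : Set V) η * (ind E η * (if η ∈ {η : BondConfig V | h₁ ∈ cl η.toFinset h₀} then 1 else q)) :=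
    fun E => Finset.sum_nonneg fun η _ => mul_nonneg (rcWeightW_nonneg wK hq.le _ η) (mul_nonneg (ind_nonneg E η) (by
      split_ifs
      · exact zero_le_one
      · exact hq.le))
  -- the dictionary for the four cells
  have eT := sum_eq (q := q) h01 hsepD w wX wK hw hX hX' hY hY' (EG := {η : BondConfig V | b ∈ cl η.toFinset a ∧ c ∈ cl η.toFinset a}) (FA := {η : BondConfig V | b ∈ cl η.toFinset a ∧ h₀ ∈ cl η.toFinset a}) (FB := (∅ : Set (BondConfig V))) (FC := {η : BondConfig V | b ∈ cl η.toFinset a ∧ h₀ ∈ cl η.toFinset a}) (FD := {η : BondConfig V | b ∈ cl η.toFinset a ∧ h₁ ∈ cl η.toFinset a})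
    (FE := (∅ : Set (BondConfig V))) (FF := (∅ : Set (BondConfig V))) (FG := (∅ : Set (BondConfig V))) (FH := (∅ : Set (BondConfig V)))
    (fun ω hω hS => (rep_A h01 hb0 hb1 hc0 hc1 hbc hca hsepD haX hbX hcK hcX0 hcX1 hω hS).1)
    (fun ω hω hS => (rep_B h01 hb0 hb1 hc0 hc1 hbc hca hsepD haX hbX hcK hcX0 hcX1 hω hS).1)
    (fun ω hω hS => (rep_C h01 hb0 hb1 hc0 hc1 hbc hca hsepD haX hbX hcK hcX0 hcX1 hω hS).1)
    (fun ω hω hS => (rep_D h01 hb0 hb1 hc0 hc1 hbc hca hsepD haX hbX hcK hcX0 hcX1 hω hS).1)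
    (fun ω hω hS => (rep_E h01 hb0 hb1 hc0 hc1 hbc hca hsepD haX hbX hcK hcX0 hcX1 hω hS).1)
    (fun ω hω hS => (rep_F h01 hb0 hb1 hc0 hc1 hbc hca hsepD haX hbX hcK hcX0 hcX1 hω hS).1)
    (fun ω hω hS => (rep_G h01 hb0 hb1 hc0 hc1 hbc hca hsepD haX hbX hcK hcX0 hcX1 hω hS).1)
    (fun ω hω hS => (rep_H h01 hb0 hb1 hc0 hc1 hbc hca hsepD haX hbX hcK hcX0 hcX1 hω hS).1)
  have eUb := sum_eq (q := q) h01 hsepD w wX wK hw hX hX' hY hY' (EG := {η : BondConfig V | b ∈ cl η.toFinset a ∧ c ∉ cl η.toFinset a}) (FA := {η : BondConfig V | b ∈ cl η.toFinset a ∧ h₀ ∉ cl η.toFinset a}) (FB := {η : BondConfig V | b ∈ cl η.toFinset a}) (FC := {η : BondConfig V | b ∈ cl η.toFinset a ∧ h₀ ∉ cl η.toFinset a}) (FD := {η : BondConfig V | b ∈ cl η.toFinset a ∧ h₁ ∉ cl η.toFinset a})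
    (FE := {η : BondConfig V | b ∈ cl η.toFinset a}) (FF := {η : BondConfig V | b ∈ cl η.toFinset a}) (FG := {η : BondConfig V | b ∈ cl η.toFinset a}) (FH := {η : BondConfig V | b ∈ cl η.toFinset a})
    (fun ω hω hS => (rep_A h01 hb0 hb1 hc0 hc1 hbc hca hsepD haX hbX hcK hcX0 hcX1 hω hS).2.1)
    (fun ω hω hS => (rep_B h01 hb0 hb1 hc0 hc1 hbc hca hsepD haX hbX hcK hcX0 hcX1 hω hS).2.1)
    (fun ω hω hS => (rep_C h01 hb0 hb1 hc0 hc1 hbc hca hsepD haX hbX hcK hcX0 hcX1 hω hS).2.1)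
    (fun ω hω hS => (rep_D h01 hb0 hb1 hc0 hc1 hbc hca hsepD haX hbX hcK hcX0 hcX1 hω hS).2.1)
    (fun ω hω hS => (rep_E h01 hb0 hb1 hc0 hc1 hbc hca hsepD haX hbX hcK hcX0 hcX1 hω hS).2.1)
    (fun ω hω hS => (rep_F h01 hb0 hb1 hc0 hc1 hbc hca hsepD haX hbX hcK hcX0 hcX1 hω hS).2.1)
    (fun ω hω hS => (rep_G h01 hb0 hb1 hc0 hc1 hbc hca hsepD haX hbX hcK hcX0 hcX1 hω hS).2.1)
    (fun ω hω hS => (rep_H h01 hb0 hb1 hc0 hc1 hbc hca hsepD haX hbX hcK hcX0 hcX1 hω hS).2.1)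
  have eUc := sum_eq (q := q) h01 hsepD w wX wK hw hX hX' hY hY' (EG := {η : BondConfig V | b ∉ cl η.toFinset a ∧ c ∈ cl η.toFinset a}) (FA := {η : BondConfig V | b ∉ cl η.toFinset a ∧ h₀ ∈ cl η.toFinset a}) (FB := (∅ : Set (BondConfig V))) (FC := {η : BondConfig V | b ∉ cl η.toFinset a ∧ h₀ ∈ cl η.toFinset a}) (FD := {η : BondConfig V | b ∉ cl η.toFinset a ∧ h₁ ∈ cl η.toFinset a})
    (FE := (∅ : Set (BondConfig V))) (FF := (∅ : Set (BondConfig V))) (FG := (∅ : Set (BondConfig V))) (FH := (∅ : Set (BondConfig V)))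
    (fun ω hω hS => (rep_A h01 hb0 hb1 hc0 hc1 hbc hca hsepD haX hbX hcK hcX0 hcX1 hω hS).2.2.1)
    (fun ω hω hS => (rep_B h01 hb0 hb1 hc0 hc1 hbc hca hsepD haX hbX hcK hcX0 hcX1 hω hS).2.2.1)
    (fun ω hω hS => (rep_C h01 hb0 hb1 hc0 hc1 hbc hca hsepD haX hbX hcK hcX0 hcX1 hω hS).2.2.1)
    (fun ω hω hS => (rep_D h01 hb0 hb1 hc0 hc1 hbc hca hsepD haX hbX hcK hcX0 hcX1 hω hS).2.2.1)
    (fun ω hω hS => (rep_E h01 hb0 hb1 hc0 hc1 hbc hca hsepD haX hbX hcK hcX0 hcX1 hω hS).2.2.1)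
    (fun ω hω hS => (rep_F h01 hb0 hb1 hc0 hc1 hbc hca hsepD haX hbX hcK hcX0 hcX1 hω hS).2.2.1)
    (fun ω hω hS => (rep_G h01 hb0 hb1 hc0 hc1 hbc hca hsepD haX hbX hcK hcX0 hcX1 hω hS).2.2.1)
    (fun ω hω hS => (rep_H h01 hb0 hb1 hc0 hc1 hbc hca hsepD haX hbX hcK hcX0 hcX1 hω hS).2.2.1)
  have eS := sum_eq (q := q) h01 hsepD w wX wK hw hX hX' hY hY' (EG := {η : BondConfig V | b ∉ cl η.toFinset a ∧ c ∉ cl η.toFinset a ∧ Sep (DX ∪ DK) (cl η.toFinset a) b c}) (FA := {η : BondConfig V | b ∉ cl η.toFinset a ∧ h₀ ∉ cl η.toFinset a ∧ Sep DK (cl η.toFinset a) b h₀ ∧ Sep DK (cl η.toFinset a) b h₁}) (FB := {η : BondConfig V | b ∉ cl η.toFinset a ∧ (h₀ ∈ cl η.toFinset a ∨ Sep DK (cl η.toFinset a) b h₀) ∧ (h₁ ∈ cl η.toFinset a ∨ Sep DK (cl η.toFinset a) b h₁)}) (FC := {η : BondConfig V | b ∉ cl η.toFinset a ∧ h₀ ∉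 cl η.toFinset a ∧ Sep DK (cl η.toFinset a) b h₀ ∧ (h₁ ∈ cl η.toFinset a ∨ Sep DK (cl η.toFinset a) b h₁)}) (FD := {η : BondConfig V | b ∉ cl η.toFinset a ∧ h₁ ∉ cl η.toFinset a ∧ Sep DK (cl η.toFinset a) b h₁ ∧ (h₀ ∈ cl η.toFinset a ∨ Sep DK (cl η.toFinset a) b h₀)})
    (FE := {η : BondConfig V | b ∉ cl η.toFinset a ∧ (h₀ ∈ cl η.toFinset a ∨ Sep DK (cl η.toFinset a) b h₀) ∧ (h₁ ∈ cl η.toFinset a ∨ Sep DK (cl η.toFinset a) b h₁)}) (FF := {η : BondConfig V | b ∉ cl η.toFinset a ∧ (h₀ ∈ cl η.toFinset a ∨ Sep DK (cl η.toFinset a) b h₀) ∧ (h₁ ∈ cl η.toFinset a ∨ Sep DK (cl η.toFinset a) b h₁ ∨ h₀ ∈ cl η.toFinset a)}) (FG := {η : BondConfig V | b ∉ cl η.toFinset a ∧ (h₀ ∈ cl η.toFinset a ∨ Sep DK (cl η.toFinset a) b h₀ ∨ h₁ ∈ cl η.toFinset a) ∧ (h₁ ∈ cl η.toFinset a ∨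 Sep DK (cl η.toFinset a) b h₁)}) (FH := {η : BondConfig V | b ∉ cl η.toFinset a ∧ (h₀ ∈ cl η.toFinset a ∨ Sep DK (cl η.toFinset a) b h₀ ∨ h₁ ∈ cl η.toFinset a) ∧ (h₁ ∈ cl η.toFinset a ∨ Sep DK (cl η.toFinset a) b h₁ ∨ h₀ ∈ cl η.toFinset a)})
    (fun ω hω hS => (rep_A h01 hb0 hb1 hc0 hc1 hbc hca hsepD haX hbX hcK hcX0 hcX1 hω hS).2.2.2)
    (fun ω hω hS => (rep_B h01 hb0 hb1 hc0 hc1 hbc hca hsepD haX hbX hcK hcX0 hcX1 hω hS).2.2.2)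
    (fun ω hω hS => (rep_C h01 hb0 hb1 hc0 hc1 hbc hca hsepD haX hbX hcK hcX0 hcX1 hω hS).2.2.2)
    (fun ω hω hS => (rep_D h01 hb0 hb1 hc0 hc1 hbc hca hsepD haX hbX hcK hcX0 hcX1 hω hS).2.2.2)
    (fun ω hω hS => (rep_E h01 hb0 hb1 hc0 hc1 hbc hca hsepD haX hbX hcK hcX0 hcX1 hω hS).2.2.2)
    (fun ω hω hS => (rep_F h01 hb0 hb1 hc0 hc1 hbc hca hsepD haX hbX hcK hcX0 hcX1 hω hS).2.2.2)
    (fun ω hω hS => (rep_G h01 hb0 hb1 hc0 hc1 hbc hca hsepD haX hbX hcK hcX0 hcX1 hω hS).2.2.2)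
    (fun ω hω hS => (rep_H h01 hb0 hb1 hc0 hc1 hbc hca hsepD haX hbX hcK hcX0 hcX1 hω hS).2.2.2)
  -- relations and splits
  have kUm0 := rel_Um0 (a := a) (b := b) (h₀ := h₀) (h₁ := h₁) wK (q := q)
  have kUm1 := rel_Um1 (a := a) (b := b) (h₀ := h₀) (h₁ := h₁) wK (q := q)
  have kRF := rel_RF (DK := DK) (a := a) (b := b) (h₀ := h₀) (h₁ := h₁) wK (q := q)
  have kRG := rel_RG (DK := DK) (a := a) (b := b) (h₀ := h₀) (h₁ := h₁) wK (q := q)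
  have kRH := rel_RH (DK := DK) (a := a) (b := b) (h₀ := h₀) (h₁ := h₁) wK (q := q)
  have kRBUb := rel_RBUb (a := a) (b := b) (h₀ := h₀) (h₁ := h₁) wK (q := q)
  have kRBS := rel_RBS (DK := DK) (a := a) (b := b) h01 wK (q := q)
  have kD0 := sumR_le_of_pt (h₀ := h₀) (h₁ := h₁) wK hq (E₁ := {η : BondConfig V | b ∉ cl η.toFinset a ∧ h₀ ∉ cl η.toFinset a ∧ Sep DK (cl η.toFinset a) b h₀ ∧ (h₁ ∈ cl η.toFinset a ∨ Sep DK (cl η.toFinset a) b h₁)}) (E₂ := {η : BondConfig V | b ∉ cl η.toFinset a ∧ h₀ ∉ cl η.toFinset a ∧ Sep DK (cl η.toFinset a) b h₀}) (fun η h => ⟨h.1, h.2.1, h.2.2.1⟩)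
  have kD1 := sumR_le_of_pt (h₀ := h₀) (h₁ := h₁) wK hq (E₁ := {η : BondConfig V | b ∉ cl η.toFinset a ∧ h₁ ∉ cl η.toFinset a ∧ Sep DK (cl η.toFinset a) b h₁ ∧ (h₀ ∈ cl η.toFinset a ∨ Sep DK (cl η.toFinset a) b h₀)}) (E₂ := {η : BondConfig V | b ∉ cl η.toFinset a ∧ h₁ ∉ cl η.toFinset a ∧ Sep DK (cl η.toFinset a) b h₁}) (fun η h => ⟨h.1, h.2.1, h.2.2.1⟩)
  have kJ0 := sumR_le_of_pt (h₀ := h₀) (h₁ := h₁) wK hq (E₁ := {η : BondConfig V | b ∉ cl η.toFinset a ∧ (h₀ ∈ cl η.toFinset a ∨ Sep DK (cl η.toFinset a) b h₀) ∧ (h₁ ∈ cl η.toFinset a ∨ Sep DK (cl η.toFinset a) b h₁)}) (E₂ := {η : BondConfig V | b ∉ cl η.toFinset a ∧ (h₀ ∈ cl η.toFinset a ∨ Sep DK (cl η.toFinset a) b h₀) ∧ (h₁ ∈ cl η.toFinset a ∨ Sep DK (cl η.toFinset a) b h₁ ∨ h₀ ∈ cl η.toFinset a)})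
    (fun η h => ⟨h.1, h.2.1, h.2.2.elim Or.inl (fun h' => Or.inr (Or.inl h'))⟩)
  have kJ1 := sumR_le_of_pt (h₀ := h₀) (h₁ := h₁) wK hq (E₁ := {η : BondConfig V | b ∉ cl η.toFinset a ∧ (h₀ ∈ cl η.toFinset a ∨ Sep DK (cl η.toFinset a) b h₀) ∧ (h₁ ∈ cl η.toFinset a ∨ Sep DK (cl η.toFinset a) b h₁)}) (E₂ := {η : BondConfig V | b ∉ cl η.toFinset a ∧ (h₀ ∈ cl η.toFinset a ∨ Sep DK (cl η.toFinset a) b h₀ ∨ h₁ ∈ cl η.toFinset a) ∧ (h₁ ∈ cl η.toFinset a ∨ Sep DK (cl η.toFinset a) b h₁)})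
    (fun η h => ⟨h.1, h.2.1.elim Or.inl (fun h' => Or.inr (Or.inl h')), h.2.2⟩)
  have xE := sum_E_split (DX := DX) (c := c) (h₀ := h₀) (h₁ := h₁) wX (q := q)
  have xN := sum_N_split (c := c) (h₀ := h₀) (h₁ := h₁) wX (q := q) hX'
  have xM := sum_M_split (c := c) (h₀ := h₀) (h₁ := h₁) wX (q := q) hX'
  -- hypotheses to masses
  simp only [rcMeasureW_real_eq_sum_div wK hq] at hR10 hR11 hR1w hHC10 hHC11 hHC2 hHC3
  simp only [free_eq_jf (h₀ := h₀) (h₁ := h₁) h01 wK] at hR10 hR11 hHC10 hHC11 hHC2 hHC3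
  rw [div_mul_div_comm, div_mul_div_comm, div_le_div_iff_of_pos_right (mul_pos hZK hZK)] at hR10 hR11
  rw [div_mul_div_comm, div_mul_div_comm, div_le_div_iff_of_pos_right (mul_pos hZW hZW)] at hR1w
  rw [div_mul_div_comm, div_mul_div_comm, div_mul_div_comm, div_mul_div_comm,
    mul_comm (rcPartitionFunctionW wK q ({h₀, h₁} : Set V)) (rcPartitionFunctionW wK q ∅), ← add_div, ← add_div,
    div_le_div_iff_of_pos_right (mul_pos hZK hZW)] at hHC10 hHC11
  rw [div_mul_div_comm, div_mul_div_comm, mul_comm (rcPartitionFunctionW wK q ({h₀, h₁} : Set V)) (rcPartitionFunctionW wK q ∅),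
    div_le_div_iff_of_pos_right (mul_pos hZK hZW)] at hHC2
  rw [div_mul_div_comm, div_mul_div_comm, div_mul_div_comm, div_mul_div_comm, ← add_div, ← add_div,
    div_le_div_iff_of_pos_right (mul_pos hZK hZK)] at hHC3
  -- goal to masses, times `K²`, through the dictionary
  simp only [rcMeasureW_real_eq_sum_div w hq]
  rw [div_mul_div_comm, div_mul_div_comm]
  refine div_le_div_of_nonneg_right ?_ (mul_pos hZ hZ).le
  refine le_of_mul_le_mul_right (a := q ^ clusterCount (∅ : BondConfig V) ({h₀, h₁} : Set V) * q ^ clusterCount (∅ : BondConfig V) ({h₀, h₁} : Set V)) ?_ (mul_pos hK hK)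
  rw [show ∀ x y K : ℝ, x * y * (K * K) = (x * K) * (y * K) from fun x y K => by ring, eT, eS,
    show ∀ x y K : ℝ, x * y * (K * K) = (x * K) * (y * K) from fun x y K => by ring, eUb, eUc, zeroW wK q, zeroR wK q]
  exact split21_pos rfl rfl rfl rfl rfl rfl rfl rfl rfl rfl hq pXA (hnnX _) (hnnX _) (hnnX _) (hnnW _) (hnnR _) (hnnR _)
    kUm0 kUm1 kRBUb kRBS kRF kRG kRH kD0 kD1 kJ0 kJ1 hR1w hR10 hR11 hHC10 hHC11 hHC2 hHC3 _ _ _ xE xN xM φX ρX σX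


include h01 hb0 hb1 hc0 hc1 hbc hca hsepD haX hbX hcK hcX0 hcX1 hD hq hw hX hX' hY hY' in
/-- **R1 across a terminal-isolating hub pair, `q ≥ 1`**: the arm's FKG slack is automatic (`ApexTwoSum.fkg_slack_of_one_le`). [this work] -/
theorem r1_of_near_side_of_one_le (hq1 : 1 ≤ q)
    (hR1X : (rcMeasureW wX q ∅).real {η : BondConfig V | c ∈ cl η.toFinset h₀ ∧ h₁ ∈ cl η.toFinset h₀} * (rcMeasureW wX q ∅).real {η : BondConfig V | c ∉ cl η.toFinset h₀ ∧ h₁ ∉ cl η.toFinset h₀ ∧ Sep DX (cl η.toFinset h₀) c h₁} ≤ (rcMeasureW wX q ∅).real {η : BondConfig V | c ∈ cl η.toFinset h₀ ∧ h₁ ∉ cl η.toFinset h₀} * (rcMeasureW wX q ∅).real {η : BondConfig V | c ∉ cl η.toFinset h₀ ∧ h₁ ∈ cl η.toFinset h₀}) (hR2X : (rcMeasureW wX q ∅).real {η : BondConfig V | c ∈ cl η.toFinset h₁ ∧ h₀ ∈ cl η.toFinset h₁} * (rcMeasureW wX q ∅).real {η : BondConfig V | c ∉ cl η.toFinset h₁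 ∧ h₀ ∉ cl η.toFinset h₁ ∧ Sep DX (cl η.toFinset h₁) c h₀} ≤ (rcMeasureW wX q ∅).real {η : BondConfig V | c ∈ cl η.toFinset h₁ ∧ h₀ ∉ cl η.toFinset h₁} * (rcMeasureW wX q ∅).real {η : BondConfig V | c ∉ cl η.toFinset h₁ ∧ h₀ ∈ cl η.toFinset h₁})
    (hAX : (rcMeasureW wX q ∅).real {η : BondConfig V | c ∈ cl η.toFinset h₀ ∧ h₁ ∈ cl η.toFinset h₀} ≠ 0)
    (hR10 : (rcMeasureW wK q ∅).real {η : BondConfig V | b ∈ cl η.toFinset a ∧ h₀ ∈ cl η.toFinset a} * (rcMeasureW wK q ∅).real {η : BondConfig V | b ∉ cl η.toFinset a ∧ h₀ ∉ cl η.toFinset a ∧ Sep DK (cl η.toFinset a) b h₀} ≤ (rcMeasureW wK q ∅).real {η : BondConfig V | b ∈ cl η.toFinset a ∧ h₀ ∉ cl η.toFinset a} * (rcMeasureW wK q ∅).real {η : BondConfig V | b ∉ cl η.toFinset a ∧ h₀ ∈ cl η.toFinset a}) (hR11 : (rcMeasureW wK q ∅).real {η : BondConfig V | b ∈ cl η.toFinset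 a ∧ h₁ ∈ cl η.toFinset a} * (rcMeasureW wK q ∅).real {η : BondConfig V | b ∉ cl η.toFinset a ∧ h₁ ∉ cl η.toFinset a ∧ Sep DK (cl η.toFinset a) b h₁} ≤ (rcMeasureW wK q ∅).real {η : BondConfig V | b ∈ cl η.toFinset a ∧ h₁ ∉ cl η.toFinset a} * (rcMeasureW wK q ∅).real {η : BondConfig V | b ∉ cl η.toFinset a ∧ h₁ ∈ cl η.toFinset a})
    (hR1w : (rcMeasureW wK q ({h₀, h₁} : Set V)).real {η : BondConfig V | insert s(h₀, h₁) η ∈ {η : BondConfig V | b ∈ cl η.toFinset a ∧ h₀ ∈ cl η.toFinset a}} * (rcMeasureW wK q ({h₀, h₁} : Set V)).real {η : BondConfig V | insert s(h₀, h₁) η ∈ {η : BondConfig V | b ∉ cl η.toFinset a ∧ h₀ ∉ cl η.toFinset a ∧ Sep DK (cl η.toFinset a) b h₀ ∧ Sep DK (cl η.toFinset a) b h₁}} ≤ (rcMeasureW wK q ({h₀, h₁} : Set V)).real {η : BondConfig V | insert s(h₀, h₁) η ∈ {η : BondConfig V | b ∈ cl η.toFinset a ∧ h₀ ∉ cl η.toFinset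 a}} * (rcMeasureW wK q ({h₀, h₁} : Set V)).real {η : BondConfig V | insert s(h₀, h₁) η ∈ {η : BondConfig V | b ∉ cl η.toFinset a ∧ h₀ ∈ cl η.toFinset a}})
    (hHC10 : (rcMeasureW wK q ∅).real {η : BondConfig V | b ∉ cl η.toFinset a ∧ h₀ ∉ cl η.toFinset a ∧ Sep DK (cl η.toFinset a) b h₀ ∧ (h₁ ∈ cl η.toFinset a ∨ Sep DK (cl η.toFinset a) b h₁)} * (rcMeasureW wK q ({h₀, h₁} : Set V)).real {η : BondConfig V | insert s(h₀, h₁) η ∈ {η : BondConfig V | b ∈ cl η.toFinset a ∧ h₀ ∈ cl η.toFinset a}} + (rcMeasureW wK q ({h₀, h₁} : Set V)).real {η : BondConfig V | insert s(h₀, h₁) η ∈ {η : BondConfig V | b ∉ cl η.toFinset a ∧ h₀ ∉ cl η.toFinset a ∧ Sep DK (cl η.toFinset a) b h₀ ∧ Sep DK (cl η.toFinset a) b h₁}} * (rcMeasureW wK q ∅).real {η : BondConfig V | b ∈ cl η.toFinset a ∧ h₀ ∈ cl η.toFinset a} ≤ (rcMeasureW wK q ∅).real {η : BondConfig V | b ∉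 cl η.toFinset a ∧ h₀ ∈ cl η.toFinset a} * (rcMeasureW wK q ({h₀, h₁} : Set V)).real {η : BondConfig V | insert s(h₀, h₁) η ∈ {η : BondConfig V | b ∈ cl η.toFinset a ∧ h₀ ∉ cl η.toFinset a}} + (rcMeasureW wK q ({h₀, h₁} : Set V)).real {η : BondConfig V | insert s(h₀, h₁) η ∈ {η : BondConfig V | b ∉ cl η.toFinset a ∧ h₀ ∈ cl η.toFinset a}} * (rcMeasureW wK q ∅).real {η : BondConfig V | b ∈ cl η.toFinset a ∧ h₀ ∉ cl η.toFinset a})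
    (hHC11 : (rcMeasureW wK q ∅).real {η : BondConfig V | b ∉ cl η.toFinset a ∧ h₁ ∉ cl η.toFinset a ∧ Sep DK (cl η.toFinset a) b h₁ ∧ (h₀ ∈ cl η.toFinset a ∨ Sep DK (cl η.toFinset a) b h₀)} * (rcMeasureW wK q ({h₀, h₁} : Set V)).real {η : BondConfig V | insert s(h₀, h₁) η ∈ {η : BondConfig V | b ∈ cl η.toFinset a ∧ h₀ ∈ cl η.toFinset a}} + (rcMeasureW wK q ({h₀, h₁} : Set V)).real {η : BondConfig V | insert s(h₀, h₁) η ∈ {η : BondConfig V | b ∉ cl η.toFinset a ∧ h₀ ∉ cl η.toFinset a ∧ Sep DK (cl η.toFinset a) b h₀ ∧ Sep DK (cl η.toFinset a) b h₁}} * (rcMeasureW wK q ∅).real {η : BondConfig V | b ∈ cl η.toFinset a ∧ h₁ ∈ cl η.toFinset a} ≤ (rcMeasureW wK q ∅).real {η : BondConfig V | b ∉ cl η.toFinset a ∧ h₁ ∈ cl η.toFinset a} * (rcMeasureW wK q ({h₀, h₁} : Set V)).real {η : BondConfig V | insert s(h₀, h₁) η ∈ {η : BondConfig V | b ∈ cl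 η.toFinset a ∧ h₀ ∉ cl η.toFinset a}} + (rcMeasureW wK q ({h₀, h₁} : Set V)).real {η : BondConfig V | insert s(h₀, h₁) η ∈ {η : BondConfig V | b ∉ cl η.toFinset a ∧ h₀ ∈ cl η.toFinset a}} * (rcMeasureW wK q ∅).real {η : BondConfig V | b ∈ cl η.toFinset a ∧ h₁ ∉ cl η.toFinset a})
    (hHC2 : (rcMeasureW wK q ∅).real {η : BondConfig V | b ∉ cl η.toFinset a ∧ (h₀ ∈ cl η.toFinset a ∨ Sep DK (cl η.toFinset a) b h₀) ∧ (h₁ ∈ cl η.toFinset a ∨ Sep DK (cl η.toFinset a) b h₁)} * (rcMeasureW wK q ({h₀, h₁} : Set V)).real {η : BondConfig V | insert s(h₀, h₁) η ∈ {η : BondConfig V | b ∈ cl η.toFinset a ∧ h₀ ∈ cl η.toFinset a}} ≤ (rcMeasureW wK q ({h₀, h₁} : Set V)).real {η : BondConfig V | insert s(h₀, h₁) η ∈ {η : BondConfig V | b ∉ cl η.toFinset a ∧ h₀ ∈ cl η.toFinset a}} * (rcMeasureW wK q ∅).real {η : BondConfig V | b ∈ cl η.toFinset a})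
    (hHC3 : (rcMeasureW wK q ∅).real {η : BondConfig V | b ∉ cl η.toFinset a ∧ h₀ ∉ cl η.toFinset a ∧ Sep DK (cl η.toFinset a) b h₀ ∧ (h₁ ∈ cl η.toFinset a ∨ Sep DK (cl η.toFinset a) b h₁)} * (rcMeasureW wK q ∅).real {η : BondConfig V | b ∈ cl η.toFinset a ∧ h₁ ∈ cl η.toFinset a} + (rcMeasureW wK q ∅).real {η : BondConfig V | b ∉ cl η.toFinset a ∧ h₁ ∉ cl η.toFinset a ∧ Sep DK (cl η.toFinset a) b h₁ ∧ (h₀ ∈ cl η.toFinset a ∨ Sep DK (cl η.toFinset a) b h₀)} * (rcMeasureW wK q ∅).real {η : BondConfig V | b ∈ cl η.toFinset a ∧ h₀ ∈ cl η.toFinset a} ≤ (rcMeasureW wK q ∅).real {η : BondConfig V | b ∉ cl η.toFinset a ∧ h₀ ∈ cl η.toFinset a} * (rcMeasureW wK q ∅).real {η : BondConfig V | b ∈ cl η.toFinset a ∧ h₁ ∉ cl η.toFinset a} + (rcMeasureW wK q ∅).real {η : BondConfig V | b ∉ cl η.toFinset a ∧ h₁ ∈ cl η.toFinset a} * (rcMeasureW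 wK q ∅).real {η : BondConfig V | b ∈ cl η.toFinset a ∧ h₀ ∉ cl η.toFinset a}) :
    (rcMeasureW w q ∅).real {η : BondConfig V | b ∈ cl η.toFinset a ∧ c ∈ cl η.toFinset a} * (rcMeasureW w q ∅).real {η : BondConfig V | b ∉ cl η.toFinset a ∧ c ∉ cl η.toFinset a ∧ Sep D (cl η.toFinset a) b c} ≤ (rcMeasureW w q ∅).real {η : BondConfig V | b ∈ cl η.toFinset a ∧ c ∉ cl η.toFinset a} * (rcMeasureW w q ∅).real {η : BondConfig V | b ∉ cl η.toFinset a ∧ c ∈ cl η.toFinset a} :=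
  r1_of_near_side h01 hb0 hb1 hc0 hc1 hbc hca hsepD haX hbX hcK hcX0 hcX1 hD w wX wK hq hw hX hX' hY hY' hR1X hR2X
    (ApexTwoSum.fkg_slack_of_one_le wX hq1) hAX hR10 hR11 hR1w hHC10 hHC11 hHC2 hHC3

end Main

end HubPairTerm

end Summit.CriticalPhenomena.PercolationContinuityZ3.Theorems
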